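import Summits.QuantumAdvantage.QuantumAdvantage.Theses.CubicForrelation
import Summits.QuantumAdvantage.QuantumAdvantage.Theorems.CubicForrelationNearExactIsExactMmWalsh

/-!
# `NearExactIsExact` (stmt-QuantumAdvantage-14043) — negative-side structure: the fixed-point formula for
TWO-SIDED Maiorana–McFarland pairs

Disprover seat `b2b-cforr-disprove-g2` (2026-08-18).  HONEST FRAMING: a STRUCTURE LEMMA (pure finite-sum identity,
[folklore]) used to evaluate and bound forrelation values of explicit cubic pairs; it is not summit progress.

If BOTH functions are in Maiorana–McFarland sign form for the SAME split `m + m`,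
`(-1)^{g(y₁ ‖ y₂)} = (-1)^{y₁·π(y₂)} (-1)^{h(y₂)}` and `(-1)^{f(x₁ ‖ x₂)} = (-1)^{x₂·τ(x₁)} (-1)^{r(x₁)}`
(arbitrary maps `π τ : 𝔽₂^m → 𝔽₂^m`, arbitrary `h r`; no bijectivity, no degree hypotheses), then

  `Φ(f, g) = 2^{-m} ∑_{y₂ : τ(π(y₂)) = y₂} (-1)^{h(y₂)} (-1)^{r(π(y₂))}`        (`forrelation_mmPair`),

i.e. `Φ = (N⁺ − N⁻)/2^m` where `N^± ` count the fixed points `y₂` of `τ ∘ π` with `h(y₂) = r(π y₂)` resp. `≠`.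
Consequences recorded here: `|Φ| ≤ #Fix(τ ∘ π)/2^m` (`abs_forrelation_mmPair_le`), and for `τ ∘ π = id` the pair is
exact iff `h = r ∘ π` and in general `Φ = 2^{-m} ∑_{y₂} (-1)^{h(y₂) ⊕ r(π y₂)}` (`forrelation_mmPair_of_leftInverse`).

Why it matters for the crux (see the seat's DISPROOF.md §6–§9): for CUBIC pairs `π, τ` have quadratic coordinates, so
`τ ∘ π ⊕ id` has coordinates of degree `≤ 4` and is either `≡ 0` or non-zero on at least `2^{m-4}` points.  Hence EITHER
`τ ∘ π ≠ id`, and then (each non-fixed `y₂` contributing `0`) `|Φ| ≤ 1 - 2^{-4} = 15/16` at every `n` — `15/16` is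
attained at `n = 16` (`Negative/FifteenSixteenths.lean`, `240` fixed points) and the records `57/64` at `n = 12, 14`
(`Negative/F8ChainTwelve.lean`, `Negative/ProductFourteen.lean`: `57` resp. `114` fixed points) are instances — OR
`τ ∘ π = id` (`π` a quadratic permutation with quadratic inverse, `g` bent), and then `Φ = 1 - 2·#{y₂ : h(y₂) ≠ r(π y₂)}/2^m`
with `h ⊕ r∘π` in the code `RM(3,m) + RM(3,m)∘τ`: its minimum distance is `≥ 2^{m-5}` for `m ≤ 8` by Hou's dual-degree
bound (tree: `tw_bent_end`) and was found `= 2^{m-4}` (value `7/8`) for every one of `3170` sampled `τ`, `m = 5..9`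
(seat conjecture "BQQ"; OPEN in general — this bijective sub-case is where the class is not closed off by counting).
The identity also lets structural certificates replace `native_decide` at `n ≥ 18`.

Proof: `stub_mmWalsh` (landed, line `direct-sum-amplification`) reduces `Φ` to the fibre sums
`∑_{x₂} (-1)^{f(π(y₂) ‖ x₂)} (-1)^{x₂·y₂}`, and under the sign form of `f` each fibre sum is a character sum,
`= 2^m (-1)^{r(π y₂)} [y₂ = τ(π y₂)]` (`fibre_sum`, from `mw_sum_linear_block`).
References (orientation only): R. L. McFarland, JCTA 15 (1973); C. Carlet, Boolean Functions for Cryptography and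
Coding Theory (2021) §6.1.
-/

set_option linter.dupNamespace false -- D-0017: single-problem summit ⇒ `QuantumAdvantage.QuantumAdvantage` by design

namespace Summit.QuantumAdvantage.QuantumAdvantage.Theorems.NearExactIsExact.Negative.MmPairFixedPoints

open Finset
open Literature.Computability.QuantumComplexity
open Summit.QuantumAdvantage.QuantumAdvantage.Theorems.CubicForrelation.NearExactIsExact (mw_sum_linear_block stub_mmWalsh)

variable {m : ℕ}

/-- **Fibre character sum.** If `(-1)^{f(x₁ ‖ x₂)} = (-1)^{x₂·τ(x₁)} (-1)^{r(x₁)}`, then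
`∑_{x₂} (-1)^{f(x₁ ‖ x₂)} (-1)^{x₂·y₂} = 2^m (-1)^{r(x₁)} [y₂ = τ(x₁)]`. [folklore] -/
theorem fibre_sum (f : (Fin (m + m) → Bool) → Bool) (τ : (Fin m → Bool) → (Fin m → Bool))
    (r : (Fin m → Bool) → Bool)
    (hf : ∀ x₁ x₂ : Fin m → Bool, signOf (f (Fin.append x₁ x₂)) = twist x₂ (τ x₁) * signOf (r x₁))
    (x₁ y₂ : Fin m → Bool) :
    ∑ x₂ : Fin m → Bool, signOf (f (Fin.append x₁ x₂)) * twist x₂ y₂ =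
      if y₂ = τ x₁ then (2 : ℝ) ^ m * signOf (r x₁) else 0 := by
  have e : ∀ x₂ : Fin m → Bool, signOf (f (Fin.append x₁ x₂)) * twist x₂ y₂ =
      signOf (r x₁) * (twist (τ x₁) x₂ * twist x₂ y₂) := by
    intro x₂
    rw [hf, twist_comm x₂ (τ x₁)]
    ring
  rw [sum_congr rfl fun x₂ _ => e x₂, ← mul_sum, mw_sum_linear_block]
  split_ifs <;> ring

/-- **Fixed-point formula for two-sided Maiorana–McFarland pairs.**
`Φ(f, g) = 2^{-m} ∑_{y₂} [y₂ = τ(π y₂)] (-1)^{h(y₂)} (-1)^{r(π y₂)}` (`= (N⁺ − N⁻)/2^m`). [folklore] -/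
theorem forrelation_mmPair (f g : (Fin (m + m) → Bool) → Bool) (π τ : (Fin m → Bool) → (Fin m → Bool))
    (h r : (Fin m → Bool) → Bool)
    (hg : ∀ y₁ y₂ : Fin m → Bool, signOf (g (Fin.append y₁ y₂)) = twist y₁ (π y₂) * signOf (h y₂))
    (hf : ∀ x₁ x₂ : Fin m → Bool, signOf (f (Fin.append x₁ x₂)) = twist x₂ (τ x₁) * signOf (r x₁)) :
    forrelation f g = ((2 : ℝ) ^ m)⁻¹ *
      ∑ y₂ : Fin m → Bool, (if y₂ = τ (π y₂) then signOf (h y₂) * signOf (r (π y₂)) else 0) := by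
  rw [stub_mmWalsh m f g π h hg]
  have e : ∀ y₂ : Fin m → Bool,
      signOf (h y₂) * ∑ x₂ : Fin m → Bool, signOf (f (Fin.append (π y₂) x₂)) * twist x₂ y₂ =
        (2 : ℝ) ^ m * (if y₂ = τ (π y₂) then signOf (h y₂) * signOf (r (π y₂)) else 0) := by
    intro y₂
    rw [fibre_sum f τ r hf]
    split_ifs <;> ring
  have h2 : (2 : ℝ) ^ m ≠ 0 := by positivity
  rw [sum_congr rfl fun y₂ _ => e y₂, ← mul_sum, ← mul_assoc,
    show (2 : ℝ) ^ (2 * m) = 2 ^ m * 2 ^ m by rw [two_mul, pow_add], mul_inv, mul_assoc ((2 : ℝ) ^ m)⁻¹,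
    inv_mul_cancel₀ h2, mul_one]

/-- **Bijective case.** If `τ ∘ π = id` (all `2^m` points fixed), `Φ(f, g) = 2^{-m} ∑_{y₂} (-1)^{h(y₂)} (-1)^{r(π y₂)}`
`= 1 − 2·#{y₂ : h(y₂) ≠ r(π y₂)}/2^m`; in particular the pair is exact iff `h = r ∘ π`. [folklore] -/
theorem forrelation_mmPair_of_leftInverse (f g : (Fin (m + m) → Bool) → Bool)
    (π τ : (Fin m → Bool) → (Fin m → Bool)) (h r : (Fin m → Bool) → Bool)
    (hg : ∀ y₁ y₂ : Fin m → Bool, signOf (g (Fin.append y₁ y₂)) = twist y₁ (π y₂) * signOf (h y₂))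
    (hf : ∀ x₁ x₂ : Fin m → Bool, signOf (f (Fin.append x₁ x₂)) = twist x₂ (τ x₁) * signOf (r x₁))
    (hinv : ∀ y₂ : Fin m → Bool, τ (π y₂) = y₂) :
    forrelation f g = ((2 : ℝ) ^ m)⁻¹ * ∑ y₂ : Fin m → Bool, signOf (h y₂) * signOf (r (π y₂)) := by
  rw [forrelation_mmPair f g π τ h r hg hf]
  congr 1
  exact sum_congr rfl fun y₂ _ => if_pos (hinv y₂).symm

/-- `|(-1)^a (-1)^b| = 1`. [folklore] -/
theorem abs_signOf_mul_signOf (a b : Bool) : |signOf a * signOf b| = 1 := by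
  cases a <;> cases b <;> simp [signOf]

/-- **Fixed-point bound.** `|Φ(f, g)| ≤ #{y₂ : τ(π y₂) = y₂} / 2^m` for two-sided Maiorana–McFarland pairs.  For cubic
pairs (`π, τ` with quadratic coordinates) the non-fixed set is the non-zero set of a map with coordinates of degree
`≤ 4`, hence empty or of size `≥ 2^{m-4}`: `|Φ| ≤ 15/16` unless `τ ∘ π = id` (the bent, bijective sub-case, where
`Φ = 1 - 2·#{y₂ : h(y₂) ≠ r(π y₂)}/2^m` exactly — see the module docstring). [folklore] -/
theorem abs_forrelation_mmPair_le (f g : (Fin (m + m) → Bool) → Bool) (π τ : (Fin m → Bool) → (Fin m → Bool))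
    (h r : (Fin m → Bool) → Bool)
    (hg : ∀ y₁ y₂ : Fin m → Bool, signOf (g (Fin.append y₁ y₂)) = twist y₁ (π y₂) * signOf (h y₂))
    (hf : ∀ x₁ x₂ : Fin m → Bool, signOf (f (Fin.append x₁ x₂)) = twist x₂ (τ x₁) * signOf (r x₁)) :
    |forrelation f g| ≤ ((univ.filter fun y₂ : Fin m → Bool => y₂ = τ (π y₂)).card : ℝ) / (2 : ℝ) ^ m := by
  rw [forrelation_mmPair f g π τ h r hg hf, abs_mul, abs_inv, abs_of_pos (by positivity : (0 : ℝ) < 2 ^ m),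
    div_eq_inv_mul]
  refine mul_le_mul_of_nonneg_left ?_ (by positivity)
  refine (abs_sum_le_sum_abs _ _).trans ?_
  rw [← sum_boole]
  refine sum_le_sum fun y₂ _ => ?_
  split_ifs
  · rw [abs_signOf_mul_signOf]
  · simp

end Summit.QuantumAdvantage.QuantumAdvantage.Theorems.NearExactIsExact.Negative.MmPairFixedPoints
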